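import Literature.NumberTheory.LFunctions.LinnikZeroSumFromDensity
import HarnessLib

/-!
# Granville–Mollin (3.3) from a low-height log-free density estimate with the
# Deuring–Heilbronn factor ("Theorem J"), in `q`-units

Topic `Literature/NumberTheory/LFunctions`, namespace `SiegelZero`. THEOREMS only (no named fact is
introduced; the density estimate is an explicit hypothesis of the final theorem).

`Literature.NumberTheory.LFunctions.SiegelZero.GranvilleMollin2000_eq33` (Granville–Mollin, *Rabinowitsch
revisited*, Acta Arith. 96 (2000), §3 (3.3)) is, in print, "(3.2) inserted into (3.1) with
`T = |d| log³ x`", where (3.2) is Bombieri's zero sum `∑∑' x^{Re ρ} ≪ x^{1/2}T³ + δ x^{1−c/log T}`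
(*Le grand crible*, pp. 54–55) — the tree's `GranvilleMollin2000_eq33_of_explicitFormula_of_eq32`
(`GranvilleMollinLinnikProofs.lean`) and `GranvilleMollin2000_eq33_of_logFreeDensity`
(`LinnikZeroSumFromDensity.lean`, from Bombieri's Théorème 14 in `T`-units, `T ≥ q`).  This file gives a
second reduction which asks for the density estimate ONLY AT LOW HEIGHT `|γ| ≤ q^{θ₁}` and in `q`-units —
the natural output of the Heath-Brown–Jutila machinery for one modulus (Heath-Brown, PLMS 64 (1992),
§§11–13; Jutila, Math. Scand. 41 (1977), Thm 2) — at the price of Siegel's theorem (ineffective, as (3.3)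
itself: "`|d|` sufficiently large"):

* `GranvilleMollin2000_eq33_of_dhDensity` — **(3.3) from "Theorem J"**: suppose there are `λ* > 0`,
  `0 < θ₁ ≤ 1`, `0 ≤ a < 9`, `K_J ≥ 0`, `q_J` such that for every primitive quadratic `χ` mod `q ≥ q_J`
  and every real zero `β₁ ≥ 1 − λ*/log q` of `L(s, χ)`,
  `N(α, q^{θ₁}; χ, {β₁}) ≤ K_J · ((1 − β₁) log q) · q^{a(1−α)}` for all `1/2 ≤ α ≤ 1`
  (`Literature.NumberTheory.LFunctions.charZeroCount`, zeros counted with multiplicity, `β₁` excluded).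
  Then `GranvilleMollin2000_eq33`.

The proof ("inserting the density estimate into (3.1)", Bombieri p. 55, with two truncation heights):
write `ℓ = log x`, `L = log q`, `x > q^C`, `C > 9`, `β = 1 − 1/(ηL)` the given zero.
* Regime `ℓ ≤ κL²` (`κ = κ(c_ZFR)` absolute): truncate Montgomery–Vaughan's explicit formula
  (`truncatedExplicitFormula_psiChar_holds`, MV Thm 12.10) at `T = q^{θ₁}`; its error `(x/T) log²(qxT)
  ≪ x L⁴ q^{−θ₁}` is `≤ x^{1−c/L}/η` because `1/η = (1 − β)L ≥ C_S q^{−θ₁/4} L` (Siegel,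
  `Siegel.exists_one_sub_realZero_ge`) and `x^{−c/L} = e^{−cℓ/L} ≥ q^{−cκ} ≥ q^{−θ₁/8}`; the zeros
  `ρ ≠ β` with `|γ| ≤ q^{θ₁}` have `Re ρ ≤ 1 − c'/(3L)` (MV Thm 11.3, `DirichletZFR.exists_zeroFree`,
  and Landau–Page `exists_realZeros_unique`), so the hypothesis and the partial summation
  `charZeroPowerSum_le_of_count` (`B = q^a`, `D = K_J/η`) give
  `∑' m(ρ) x^{Re ρ} ≤ x^{1/2} N(q^{θ₁}) + e K_J (C/(C−a)) e^{−(c'/3)(ℓ/L − a)} x/η ≤ x/(qℓ) + 2K₂ x^{1−c/L}/η`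
  once `c ≤ (c'/3)(1 − a/C)`.
* Regime `ℓ > κL²`: truncate at `T = qℓ³` as Granville–Mollin (`(x/T) log²(qxT) ≤ 9x/(qℓ)`); no density
  estimate is needed: all `≪ T log T` zeros `ρ ≠ β` (`exists_boxCount_le`) have
  `x^{Re ρ − 1} ≤ x^{−c'/(3 log T)}`, and `q²ℓ⁴ log T · x^{−c'/(3 log T)} ≪ 1/(qℓ)·x/x…` — precisely
  `4e C_b qℓ³ log(qℓ³) x^{1 − c'/(3 log T)} ≤ x/(qℓ)` — both when `ℓ ≤ q` (`log T ≤ 4L`,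
  `x^{c'/(12L)} ≥ q^{c'κ/12} ≥ q⁷`) and when `ℓ > q` (`log T ≤ 4 log ℓ`, `e^{c'ℓ/(12 log ℓ)} ≥ ℓ⁷·16eC_b`).
The remaining pieces of `θ(x, χ) + x^β/β` (prime powers, `ψ − ψ₀`, the trivial zeros, `x^{1−β}/(1−β)`,
the zeros near `0`, `C(χ)`) are bounded by `x/(qℓ)` exactly as in `GranvilleMollinLinnikProofs.lean`
(`GranvilleMollinLinnikRanges.lean`, `GranvilleMollinLinnikBounds.lean`).

## References

* A. Granville, R. A. Mollin, *Rabinowitsch revisited*, Acta Arith. 96 (2000) 139–153, §3 (3.1)–(3.3).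
  [GranvilleMollin2000]
* E. Bombieri, *Le grand crible dans la théorie analytique des nombres*, Astérisque 18 (2ᵉ éd. 1987),
  §6, Théorème 14 and pp. 54–55. [Bombieri1987GrandCrible]
* D. R. Heath-Brown, *Zero-free regions for Dirichlet L-functions, and the least prime in an arithmetic
  progression*, PLMS (3) 64 (1992), §§11–13. [HeathBrown1992PLMS]
* H. L. Montgomery, R. C. Vaughan, *Multiplicative Number Theory I*, Theorems 10.17, 11.3, 12.10,
  Corollary 11.15. [MontgomeryVaughan2007]
-/

noncomputable section

open Finset Real Complex Metric

namespace Literature.NumberTheory.LFunctions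

namespace SiegelZero

open Literature.NumberTheory.LFunctions.DirichletZFR DirichletCharacter
open Literature.NumberTheory.Sieve (chebyshevPsiChar)

/-! ## Inputs at height `≤ q` -/

/-- **`N(T, χ) ≪ T log q` for `6 ≤ T ≤ q`**: the window bound `ExplicitPsiChar.exists_sum_window_le`
(MV Thm 10.17) summed over the `≤ 3T` unit windows centred at the integers `|j| ≤ ⌊T⌋ + 1`, each
`≤ C(log q + log(|j| + 4)) ≤ 3C log q` since `|j| + 4 ≤ q + 5 ≤ q²`.
[cite: MontgomeryVaughan2007, Theorem 10.17] -/
theorem exists_boxCount_le_of_le :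
    ∃ C₀ : ℝ, 0 < C₀ ∧ ∀ (q : ℕ) [NeZero q] (χ : DirichletCharacter ℂ q), χ.IsPrimitive → 1 < q →
      ∀ T : ℝ, 6 ≤ T → T ≤ (q : ℝ) → ∀ P : Finset ℂ, (∀ ρ ∈ P, ρ ∈ lfunctionZeroBox χ T) →
        ∑ ρ ∈ P, (DirichletDisc.zeroOrder χ ρ : ℝ) ≤ C₀ * T * Real.log q := by
  obtain ⟨C, hC0, hC⟩ := ExplicitPsiChar.exists_sum_window_le
  refine ⟨9 * C, by positivity, fun q _ χ hprim hq T hT hTq P hP => ?_⟩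
  classical
  have hT0 : 0 < T := by linarith
  have hq6 : (6 : ℝ) ≤ q := hT.trans hTq
  have hlogq0 : 0 < Real.log q := Real.log_pos (by linarith)
  set N : ℕ := ⌊T⌋₊ + 1 with hN
  have hNT : (N : ℝ) ≤ T + 1 := by
    rw [hN]; push_cast; linarith [Nat.floor_le hT0.le]
  have hTN : T < N := by rw [hN]; push_cast; exact Nat.lt_floor_add_one T
  set j : ℂ → ℤ := fun ρ => ⌊ρ.im + 1 / 2⌋ with hj
  set t : Finset ℤ := Finset.Icc (-(N : ℤ)) N with ht
  have hmaps : ∀ ρ ∈ P, j ρ ∈ t := by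
    intro ρ hρ
    obtain ⟨-, -, -, him⟩ := (mem_lfunctionZeroBox).1 (hP ρ hρ)
    rw [abs_le] at him
    rw [ht, Finset.mem_Icc, hj]
    constructor
    · rw [Int.le_floor]; push_cast; linarith
    · rw [Int.floor_le_iff]; push_cast; linarith
  rw [← Finset.sum_fiberwise_of_maps_to hmaps]
  have hwin : ∀ i ∈ t, ∑ ρ ∈ P with j ρ = i, (DirichletDisc.zeroOrder χ ρ : ℝ) ≤
      3 * C * Real.log q := by
    intro i hi
    rw [ht, Finset.mem_Icc] at hi
    have hiabs : |(i : ℝ)| ≤ T + 1 := by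
      rw [abs_le]
      have h1 : (-(N : ℤ) : ℝ) ≤ (i : ℝ) := by exact_mod_cast hi.1
      have h2 : ((i : ℤ) : ℝ) ≤ (N : ℝ) := by exact_mod_cast hi.2
      push_cast at h1
      constructor <;> linarith
    have h := hC q χ hprim hq (i : ℝ) (P.filter fun ρ => j ρ = i) (by
      intro ρ hρ
      rw [Finset.mem_filter] at hρ
      obtain ⟨h0, h1, h2, -⟩ := (mem_lfunctionZeroBox).1 (hP ρ hρ.1)
      refine ⟨h0, h1, h2, ?_⟩
      have hfl : (i : ℝ) ≤ ρ.im + 1 / 2 ∧ ρ.im + 1 / 2 < i + 1 := by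
        have := hρ.2
        rw [hj] at this
        dsimp only at this
        rw [← this]
        exact ⟨Int.floor_le _, Int.lt_floor_add_one _⟩
      rw [abs_le]
      constructor <;> linarith [hfl.1, hfl.2])
    refine h.trans ?_
    have hli : Real.log (|(i : ℝ)| + 4) ≤ 2 * Real.log q := by
      have h1 : |(i : ℝ)| + 4 ≤ (q : ℝ) * q := by nlinarith
      calc Real.log (|(i : ℝ)| + 4) ≤ Real.log ((q : ℝ) * q) :=
            Real.log_le_log (by positivity) h1
        _ = 2 * Real.log q := by rw [Real.log_mul (by positivity) (by positivity)]; ring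
    nlinarith
  calc ∑ i ∈ t, ∑ ρ ∈ P with j ρ = i, (DirichletDisc.zeroOrder χ ρ : ℝ)
      ≤ ∑ i ∈ t, 3 * C * Real.log q := Finset.sum_le_sum hwin
    _ = (t.card : ℝ) * (3 * C * Real.log q) := by rw [Finset.sum_const, nsmul_eq_mul]
    _ ≤ (3 * T) * (3 * C * Real.log q) := by
        refine mul_le_mul_of_nonneg_right ?_ (by positivity)
        have hcard : (t.card : ℝ) = 2 * N + 1 := by
          rw [ht, Int.card_Icc]
          have : ((N : ℤ) + 1 - -(N : ℤ)).toNat = 2 * N + 1 := by omega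
          rw [this]; push_cast; ring
        rw [hcard]; linarith
    _ = 9 * C * T * Real.log q := by ring

/-- **The zeros other than the exceptional one lie in `Re ρ ≤ 1 − c'/(3 log M)`**, `M = max(q, T)`:
there is an absolute `c' > 0` such that for `χ ≠ χ₀` mod `q ≥ 3`, `T ≥ 3` and a real zero
`β > 1 − c'/log(2q)`, every non-trivial zero `ρ ≠ β` with `|Im ρ| ≤ T` has
`Re ρ ≤ 1 − c'/(3 log(max q T))` (complex zeros: MV Theorem 11.3, `DirichletZFR.exists_zeroFree`, with
`log q + log(|γ| + 4) ≤ 3 log max(q, T)`; real zeros: Landau–Page, `exists_realZeros_unique`, with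
`log 2q ≤ 3 log max(q, T)`). [cite: MontgomeryVaughan2007, Theorem 11.3] -/
theorem exists_re_le_of_ne_realZero :
    ∃ c' : ℝ, 0 < c' ∧ ∀ (q : ℕ) [NeZero q] (χ : DirichletCharacter ℂ q), χ ≠ 1 → (3 : ℝ) ≤ q →
      ∀ β : ℝ, χ.LFunction β = 0 → 1 - c' / Real.log (2 * q) < β →
      ∀ T : ℝ, 3 ≤ T → ∀ ρ ∈ lfunctionZeroBox χ T, ρ ≠ (β : ℂ) →
        ρ.re ≤ 1 - c' / (3 * Real.log (max (q : ℝ) T)) := by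
  obtain ⟨cZ, hcZ, hZ⟩ := DirichletZFR.exists_zeroFree
  obtain ⟨cu, hcu, hU⟩ := exists_realZeros_unique
  refine ⟨min cZ cu, lt_min hcZ hcu, fun q _ χ hχ hq3 β hβ hβc T hT ρ hρ hne => ?_⟩
  obtain ⟨h0, hre0, hre1, habs⟩ := (mem_lfunctionZeroBox).1 hρ
  set M : ℝ := max (q : ℝ) T with hM
  have hqM : (q : ℝ) ≤ M := le_max_left _ _
  have hTM : T ≤ M := le_max_right _ _
  have hM3 : 3 ≤ M := hT.trans hTM
  have hM0 : 0 < M := by linarith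
  have hlogM0 : 0 < Real.log M := Real.log_pos (by linarith)
  have hq0 : (0 : ℝ) < q := by linarith
  have hc' : 0 < min cZ cu := lt_min hcZ hcu
  by_contra hcon
  push Not at hcon
  -- `log q + log(|γ| + 4) ≤ 3 log M` and `log 2q ≤ 3 log M`
  have hℒ : Real.log q + Real.log (|ρ.im| + 4) ≤ 3 * Real.log M := by
    have h1 : Real.log q ≤ Real.log M := Real.log_le_log hq0 hqM
    have h2 : Real.log (|ρ.im| + 4) ≤ 2 * Real.log M := by
      have : |ρ.im| + 4 ≤ M * M := by nlinarith [abs_nonneg ρ.im, habs.trans hTM]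
      calc Real.log (|ρ.im| + 4) ≤ Real.log (M * M) := Real.log_le_log (by positivity) this
        _ = 2 * Real.log M := by rw [Real.log_mul hM0.ne' hM0.ne']; ring
    linarith
  have hℒ1 : 1 ≤ Real.log q + Real.log (|ρ.im| + 4) := DirichletZFR.one_le_ell q ρ.im
  have h2q : Real.log (2 * q) ≤ 3 * Real.log M := by
    have : (2 : ℝ) * q ≤ M * M * M := by nlinarith [mul_le_mul hqM hqM hq0.le hM0.le]
    calc Real.log (2 * q) ≤ Real.log (M * M * M) := Real.log_le_log (by positivity) this
      _ = 3 * Real.log M := by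
          rw [Real.log_mul (by positivity) hM0.ne', Real.log_mul hM0.ne' hM0.ne']; ring
  have h2q0 : 0 < Real.log (2 * q) := Real.log_pos (by linarith)
  rcases eq_or_ne ρ.im 0 with him | him
  · -- a real zero `ρ = ρ.re`
    have hρeq : ρ = ((ρ.re : ℝ) : ℂ) := by
      apply Complex.ext <;> simp [him]
    have hLρ : χ.LFunction (ρ.re : ℝ) = 0 := by rw [← hρeq]; exact h0
    have hρc : 1 - cu / Real.log (2 * q) < ρ.re := by
      have : min cZ cu / (3 * Real.log M) ≤ cu / Real.log (2 * q) := by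
        calc min cZ cu / (3 * Real.log M) ≤ cu / (3 * Real.log M) :=
              div_le_div_of_nonneg_right (min_le_right _ _) (by positivity)
          _ ≤ cu / Real.log (2 * q) := div_le_div_of_nonneg_left hcu.le h2q0 h2q
      linarith
    have hβc' : 1 - cu / Real.log (2 * q) < β := by
      have : min cZ cu / Real.log (2 * q) ≤ cu / Real.log (2 * q) :=
        div_le_div_of_nonneg_right (min_le_right _ _) h2q0.le
      linarith
    have := hU q χ hχ ρ.re β hLρ hβ hρc hβc'
    exact hne (by rw [hρeq, this])
  · -- a complex zero: MV Theorem 11.3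
    have hregion : 1 - cZ / (Real.log q + Real.log (|ρ.im| + 4)) < ρ.re := by
      have : min cZ cu / (3 * Real.log M) ≤ cZ / (Real.log q + Real.log (|ρ.im| + 4)) := by
        calc min cZ cu / (3 * Real.log M) ≤ cZ / (3 * Real.log M) :=
              div_le_div_of_nonneg_right (min_le_left _ _) (by positivity)
          _ ≤ cZ / (Real.log q + Real.log (|ρ.im| + 4)) :=
              div_le_div_of_nonneg_left hcZ.le (by linarith) hℒ
      linarith
    exact him (hZ q χ hχ ρ h0 hregion).2

/-- `A L^k e^{−aL/log L} ≤ 1` for `L ≥ L₁(A, k, a)` (`a > 0`): `log L ≤ 2√L`, so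
`e^{−aL/log L} ≤ e^{−(a/2)√L}`, and `A u^{2k} ≤ e^{(a/2)u}` for `u = √L` large. [folklore] -/
theorem exists_mul_pow_mul_exp_neg_div_log_le_one (A : ℝ) (k : ℕ) {a : ℝ} (ha : 0 < a) :
    ∃ L₁ : ℝ, 3 ≤ L₁ ∧ ∀ L : ℝ, L₁ ≤ L → A * L ^ k * Real.exp (-(a * L / Real.log L)) ≤ 1 := by
  obtain ⟨u₀, -, hu₀⟩ := exists_mul_pow_le_exp (max A 0 + 1) (2 * k) (a / 2) (half_pos ha)
  refine ⟨max 3 (u₀ ^ 2), le_max_left _ _, fun L hL => ?_⟩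
  have hL3 : 3 ≤ L := (le_max_left _ _).trans hL
  have hL0 : 0 < L := by linarith
  have hlogL0 : 0 < Real.log L := Real.log_pos (by linarith)
  set u : ℝ := Real.sqrt L with hu
  have hu0 : 0 ≤ u := Real.sqrt_nonneg L
  have huL : u ^ 2 = L := by rw [hu, Real.sq_sqrt hL0.le]
  have hu₀u : u₀ ≤ u := by
    have : u₀ ^ 2 ≤ L := (le_max_right _ _).trans hL
    by_contra hcon
    push Not at hcon
    rcases le_or_gt 0 u₀ with h0 | h0
    · nlinarith
    · linarith
  -- `log L ≤ 2u`
  have hlog : Real.log L ≤ 2 * u := by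
    have h := Real.log_le_sub_one_of_pos (show 0 < u by
      rcases hu0.lt_or_eq with h | h
      · exact h
      · exfalso; rw [← h] at huL; linarith)
    have : Real.log L = 2 * Real.log u := by
      rw [← huL, Real.log_pow]; push_cast; ring
    rw [this]; linarith
  have hexp : Real.exp (-(a * L / Real.log L)) ≤ Real.exp (-(a / 2 * u)) := by
    rw [Real.exp_le_exp, neg_le_neg_iff]
    rw [le_div_iff₀ hlogL0]
    calc a / 2 * u * Real.log L ≤ a / 2 * u * (2 * u) := by gcongr
      _ = a * L := by rw [← huL]; ring
  have hmain : (max A 0 + 1) * u ^ (2 * k) ≤ Real.exp (a / 2 * u) := hu₀ u hu₀u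
  have hLk : L ^ k = u ^ (2 * k) := by rw [← huL, ← pow_mul]
  have hA : A ≤ max A 0 + 1 := by linarith [le_max_left A 0]
  have hpos : 0 < Real.exp (a / 2 * u) := Real.exp_pos _
  calc A * L ^ k * Real.exp (-(a * L / Real.log L))
      ≤ (max A 0 + 1) * L ^ k * Real.exp (-(a / 2 * u)) := by gcongr
    _ = (max A 0 + 1) * u ^ (2 * k) * (Real.exp (a / 2 * u))⁻¹ := by
        rw [hLk, Real.exp_neg]
    _ ≤ Real.exp (a / 2 * u) * (Real.exp (a / 2 * u))⁻¹ := by gcongr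
    _ = 1 := mul_inv_cancel₀ hpos.ne'

/-- **The bookkeeping of the final estimate** (pure linear arithmetic, the variant of
`final_combination` with a truncation error of size `≤ K₁ P`): with `X = x/(qℓ)`, `P = x^{1−c/log q}/η`,
the pieces of `θ + x^β/β` combine to `(9K₁ + 8K₂ + 8)(X + P)`. [folklore] -/
theorem final_combination₂ {θ m t₁ n₁ n₂ nE nm nA nC K₁ K₂ L X P : ℝ}
    (htri : |θ + m| ≤ t₁ + n₁ + n₂ + (nE + nm + nA + nC)) (ha : t₁ ≤ X)
    (hb : n₁ + nA + K₁ * L ≤ (K₁ + 10) * L) (hb' : (K₁ + 10) * L ≤ X) (hm : nm ≤ X)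
    (hE : nE ≤ 3 * X + 8 * K₂ * P) (hC : nC ≤ X) (hR : n₂ ≤ K₁ * L + 9 * K₁ * X + K₁ * P)
    (hX : 0 ≤ X) (hP : 0 ≤ P) (hK₁ : 0 ≤ K₁) (hK₂ : 0 ≤ K₂) :
    |θ + m| ≤ (9 * K₁ + 8 * K₂ + 8) * (X + P) := by
  have h1 : 0 ≤ K₁ * P := mul_nonneg hK₁ hP
  have h2 : 0 ≤ K₂ * X := mul_nonneg hK₂ hX
  have h3 : 0 ≤ K₁ * X := mul_nonneg hK₁ hX
  nlinarith


/-! ## The two regimes -/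

section Regimes

variable {q : ℕ} [NeZero q] {χ : DirichletCharacter ℂ q}

/-- `x^{1 − c/L} = x · e^{−cℓ/L}` for `x = e^ℓ`. [folklore] -/
theorem rpow_one_sub_div_eq {x ℓ c Lq : ℝ} (hx : x = Real.exp ℓ) :
    x ^ (1 - c / Lq) = x * Real.exp (-(c * ℓ / Lq)) := by
  rw [hx, ← Real.exp_mul, ← Real.exp_add]; congr 1; ring

/-- **The truncation error at `T = q^{θ₁}` in the regime `ℓ ≤ κ (log q)²`**:
`(x/T) log²(qxT) ≤ x^{1−c/log q} · (1 − β) log q`, from Siegel's bound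
`1 − β ≥ C_S q^{−θ₁/4}`, `cκ ≤ θ₁/8` and `(4κ²/C_S) L³ ≤ q^{5θ₁/8}`. [folklore] -/
theorem truncation_term_le_regimeM {x ℓ Lq T qr θ₁ κ c CS β : ℝ} (hx : x = Real.exp ℓ)
    (hq : qr = Real.exp Lq) (hT : T = Real.exp (θ₁ * Lq)) (hLq1 : 1 ≤ Lq) (hLqℓ : Lq ≤ ℓ / 9)
    (hℓ : ℓ ≤ κ * Lq ^ 2) (hθ₁ : 0 < θ₁) (hθ₁1 : θ₁ ≤ 1) (hc0 : 0 ≤ c)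
    (hcκ : c * κ ≤ θ₁ / 8) (hCS : 0 < CS) (hS : CS * Real.exp (-(θ₁ / 4 * Lq)) ≤ 1 - β)
    (ht : 4 * κ ^ 2 / CS * Lq ^ 3 ≤ Real.exp (5 * θ₁ / 8 * Lq)) :
    x / T * Real.log (qr * x * T) ^ 2 ≤ x ^ (1 - c / Lq) * ((1 - β) * Lq) := by
  have hx0 : 0 < x := by rw [hx]; exact Real.exp_pos ℓ
  have hT0 : 0 < T := by rw [hT]; exact Real.exp_pos _
  have hq0 : 0 < qr := by rw [hq]; exact Real.exp_pos _
  have hLq0 : 0 < Lq := by linarith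
  have hℓ0 : 0 < ℓ := by linarith
  -- `log(q x T) ≤ 2ℓ`
  have hlog : Real.log (qr * x * T) = Lq + ℓ + θ₁ * Lq := by
    rw [Real.log_mul (by positivity) hT0.ne', Real.log_mul hq0.ne' hx0.ne', hq, hx, hT,
      Real.log_exp, Real.log_exp, Real.log_exp]
  have hlog2 : Real.log (qr * x * T) ≤ 2 * ℓ := by
    rw [hlog]; nlinarith
  have hlog0 : 0 ≤ Real.log (qr * x * T) := by rw [hlog]; positivity
  have hsq : Real.log (qr * x * T) ^ 2 ≤ 4 * κ ^ 2 * Lq ^ 4 := by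
    calc Real.log (qr * x * T) ^ 2 ≤ (2 * ℓ) ^ 2 := pow_le_pow_left₀ hlog0 hlog2 2
      _ ≤ (2 * (κ * Lq ^ 2)) ^ 2 := pow_le_pow_left₀ (by positivity) (by linarith) 2
      _ = 4 * κ ^ 2 * Lq ^ 4 := by ring
  -- the exponentials
  have he1 : Real.exp (-(θ₁ / 8 * Lq)) ≤ Real.exp (-(c * ℓ / Lq)) := by
    rw [Real.exp_le_exp, neg_le_neg_iff, div_le_iff₀ hLq0]
    calc c * ℓ ≤ c * (κ * Lq ^ 2) := mul_le_mul_of_nonneg_left hℓ hc0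
      _ = (c * κ) * Lq * Lq := by ring
      _ ≤ (θ₁ / 8) * Lq * Lq := by gcongr
      _ = θ₁ / 8 * Lq * Lq := rfl
  rw [rpow_one_sub_div_eq hx]
  -- reduce to an inequality between the coefficients of `x`
  have hTinv : x / T = x * Real.exp (-(θ₁ * Lq)) := by rw [hT, Real.exp_neg]; ring
  rw [hTinv]
  have key : Real.exp (-(θ₁ * Lq)) * (4 * κ ^ 2 * Lq ^ 4) ≤
      Real.exp (-(θ₁ / 8 * Lq)) * (CS * Real.exp (-(θ₁ / 4 * Lq)) * Lq) := by
    -- multiply `ht` by `CS · e^{−θ₁ Lq} · Lq`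
    have hpos : 0 < CS * Real.exp (-(θ₁ * Lq)) * Lq := by positivity
    have h1 : Real.exp (-(θ₁ * Lq)) * (4 * κ ^ 2 * Lq ^ 4) =
        (4 * κ ^ 2 / CS * Lq ^ 3) * (CS * Real.exp (-(θ₁ * Lq)) * Lq) := by
      field_simp
    have h2 : Real.exp (-(θ₁ / 8 * Lq)) * (CS * Real.exp (-(θ₁ / 4 * Lq)) * Lq) =
        Real.exp (5 * θ₁ / 8 * Lq) * (CS * Real.exp (-(θ₁ * Lq)) * Lq) := by
      have : Real.exp (-(θ₁ / 8 * Lq)) * Real.exp (-(θ₁ / 4 * Lq)) =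
          Real.exp (5 * θ₁ / 8 * Lq) * Real.exp (-(θ₁ * Lq)) := by
        rw [← Real.exp_add, ← Real.exp_add]; ring_nf
      calc Real.exp (-(θ₁ / 8 * Lq)) * (CS * Real.exp (-(θ₁ / 4 * Lq)) * Lq)
          = (Real.exp (-(θ₁ / 8 * Lq)) * Real.exp (-(θ₁ / 4 * Lq))) * (CS * Lq) := by ring
        _ = Real.exp (5 * θ₁ / 8 * Lq) * Real.exp (-(θ₁ * Lq)) * (CS * Lq) := by rw [this]
        _ = _ := by ring
    rw [h1, h2]
    exact mul_le_mul_of_nonneg_right ht hpos.le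
  calc x * Real.exp (-(θ₁ * Lq)) * Real.log (qr * x * T) ^ 2
      ≤ x * Real.exp (-(θ₁ * Lq)) * (4 * κ ^ 2 * Lq ^ 4) := by gcongr
    _ = x * (Real.exp (-(θ₁ * Lq)) * (4 * κ ^ 2 * Lq ^ 4)) := by ring
    _ ≤ x * (Real.exp (-(θ₁ / 8 * Lq)) * (CS * Real.exp (-(θ₁ / 4 * Lq)) * Lq)) :=
        mul_le_mul_of_nonneg_left key hx0.le
    _ ≤ x * (Real.exp (-(c * ℓ / Lq)) * ((1 - β) * Lq)) := by
        refine mul_le_mul_of_nonneg_left ?_ hx0.le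
        have : CS * Real.exp (-(θ₁ / 4 * Lq)) * Lq ≤ (1 - β) * Lq :=
          mul_le_mul_of_nonneg_right hS hLq0.le
        exact mul_le_mul he1 this (by positivity) (Real.exp_pos _).le
    _ = x * Real.exp (-(c * ℓ / Lq)) * ((1 - β) * Lq) := by ring

/-- **The zeros `ρ ≠ β`, `|γ| ≤ q^{θ₁}`, in the regime `ℓ ≤ κ(log q)²`** (Bombieri p. 55 with
`B = q^a`, `D = K_J (1 − β) log q` and the zero-free strip `Re ρ ≤ 1 − c'/(3 log q)`): the density
hypothesis at level `T = q^{θ₁} ≤ q` gives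
`4 ∑' m(ρ) x^{Re ρ} ≤ x/(qℓ) + 8K₂ x^{1−c/log q} (1 − β) log q`, `K₂ = e K_J C/(2(C − a))`, for
`x = e^ℓ > q^C`, `c ≤ (c'/3)(1 − a/C)` and `4 C_w T log q · qℓ ≤ x^{1/2}`.
[cite: Bombieri1987GrandCrible, §6 Preuve du Théorème de Linnik, p. 55] -/
theorem zeroSum_le_regimeM (hχ : χ ≠ 1) {β x ℓ Lq T C a c c' KJ Cw : ℝ}
    (hβ1 : β < 1) (hx : x = Real.exp ℓ) (hLq : Lq = Real.log q)
    (hq3 : (3 : ℝ) ≤ q) (hTq : T ≤ q) (hC : 9 < C) (ha0 : 0 ≤ a) (haC : a < C)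
    (hxC : (q : ℝ) ^ C < x) (hc' : 0 < c') (hcle : c ≤ c' / 3 * (1 - a / C))
    (hη : c' / (3 * Lq) ≤ 1 / 2) (hKJ : 0 ≤ KJ)
    (hZFR : ∀ ρ ∈ lfunctionZeroBox χ T, ρ ≠ (β : ℂ) → ρ.re ≤ 1 - c' / (3 * Real.log (max (q : ℝ) T)))
    (hdens : ∀ α : ℝ, 1 / 2 ≤ α → α ≤ 1 →
      charZeroCount χ α T {(β : ℂ)} ≤ KJ * ((1 - β) * Lq) * (q : ℝ) ^ (a * (1 - α)))
    (hcount : ∀ P : Finset ℂ, (∀ ρ ∈ P, ρ ∈ lfunctionZeroBox χ T) →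
      ∑ ρ ∈ P, (DirichletDisc.zeroOrder χ ρ : ℝ) ≤ Cw * T * Lq)
    (ht : 4 * Cw * T * Lq * (q * ℓ) ≤ x ^ (1 / 2 : ℝ)) :
    4 * charZeroPowerSum χ x T {(β : ℂ)} ≤
      x / (q * ℓ) + 8 * (Real.exp 1 * KJ * C / (2 * (C - a))) * (x ^ (1 - c / Lq) * ((1 - β) * Lq)) := by
  classical
  have hq0 : (0 : ℝ) < q := by linarith
  have hq1 : (1 : ℝ) < q := by linarith
  have hLq0 : 0 < Lq := by rw [hLq]; exact Real.log_pos hq1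
  have hLq1 : 1 < Lq := by
    rw [hLq, ← Real.log_exp 1]
    refine Real.log_lt_log (Real.exp_pos 1) (lt_of_lt_of_le ?_ hq3)
    have := Real.exp_one_lt_d9; norm_num at this; linarith
  have hqexp : (q : ℝ) = Real.exp Lq := by rw [hLq, Real.exp_log hq0]
  have hC0 : 0 < C := by linarith
  have hqC1 : (1 : ℝ) ≤ (q : ℝ) ^ C := Real.one_le_rpow hq1.le hC0.le
  have hx1 : 1 < x := lt_of_le_of_lt hqC1 hxC
  have hx0 : 0 < x := by linarith
  have hℓ : ℓ = Real.log x := by rw [hx, Real.log_exp]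
  have hℓ0 : 0 < ℓ := by rw [hℓ]; exact Real.log_pos hx1
  have hCℓ : C * Lq < ℓ := by
    rw [hℓ, hLq, ← Real.log_rpow hq0]; exact Real.log_lt_log (by positivity) hxC
  -- Bombieri's partial summation
  set B : ℝ := (q : ℝ) ^ a with hB
  set D : ℝ := KJ * ((1 - β) * Lq) with hD
  set ηM : ℝ := c' / (3 * Lq) with hηM
  have hB1 : 1 ≤ B := Real.one_le_rpow hq1.le ha0
  have hBx : B < x := by
    calc B ≤ (q : ℝ) ^ C := Real.rpow_le_rpow_of_exponent_le hq1.le haC.le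
      _ < x := hxC
  have h1β : 0 < 1 - β := by linarith
  have hD0 : 0 ≤ D := by rw [hD]; positivity
  have hmax : max (q : ℝ) T = q := max_eq_left hTq
  have hre : ∀ ρ ∈ lfunctionZeroBox χ T, ρ ∉ ({(β : ℂ)} : Finset ℂ) → ρ.re ≤ 1 - ηM := by
    intro ρ hρ hρβ
    have h := hZFR ρ hρ (by simpa using hρβ)
    rwa [hmax, ← hLq] at h
  have hdens' : ∀ α : ℝ, 1 / 2 ≤ α → α ≤ 1 - ηM → charZeroCount χ α T {(β : ℂ)} ≤ D * B ^ (1 - α) := by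
    intro α hα hα1
    have hηM0 : 0 < ηM := by rw [hηM]; positivity
    have h := hdens α hα (by linarith)
    rw [hD, hB, ← Real.rpow_mul hq0.le]
    exact h
  have hN := hcount (lfunctionZeroBox_finite hχ T).toFinset (fun ρ hρ => by
    rwa [Set.Finite.mem_toFinset] at hρ)
  have hPS := charZeroPowerSum_le_of_count hχ (x := x) (T := T) {(β : ℂ)} hB1 hBx hD0 hη hre hdens' hN
  -- (i) the zeros with `Re ρ < 1/2`
  have hi : 4 * (x ^ (1 / 2 : ℝ) * (Cw * T * Lq)) ≤ x / (q * ℓ) := by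
    rw [le_div_iff₀ (by positivity)]
    have hxx : x ^ (1 / 2 : ℝ) * x ^ (1 / 2 : ℝ) = x := by
      rw [← Real.rpow_add hx0]; norm_num
    calc 4 * (x ^ (1 / 2 : ℝ) * (Cw * T * Lq)) * (q * ℓ)
        = x ^ (1 / 2 : ℝ) * (4 * Cw * T * Lq * (q * ℓ)) := by ring
      _ ≤ x ^ (1 / 2 : ℝ) * x ^ (1 / 2 : ℝ) := mul_le_mul_of_nonneg_left ht (by positivity)
      _ = x := hxx
  -- (ii) the density part
  have hii : 4 * (x * (Real.exp 1 * D * (B / x) ^ ηM * (Real.log x / Real.log (x / B)))) ≤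
      8 * (Real.exp 1 * KJ * C / (2 * (C - a))) * (x ^ (1 - c / Lq) * ((1 - β) * Lq)) := by
    -- `(B/x)^{η} = e^{−(c'/3)(ℓ/L − a)} ≤ e^{−cℓ/L}`
    have hBx' : (B / x) ^ ηM = Real.exp (-(c' / 3 * (ℓ / Lq - a))) := by
      have : B / x = Real.exp (a * Lq - ℓ) := by
        rw [hB, hqexp, ← Real.exp_mul, hx, ← Real.exp_sub]; ring_nf
      rw [this, ← Real.exp_mul, hηM]; congr 1; field_simp; ring
    have hexp : Real.exp (-(c' / 3 * (ℓ / Lq - a))) ≤ Real.exp (-(c * ℓ / Lq)) := by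
      rw [Real.exp_le_exp, neg_le_neg_iff]
      -- `c ℓ/L ≤ (c'/3)(ℓ/L − a)` from `c ≤ (c'/3)(1 − a/C)` and `ℓ/L ≥ C`
      set C₀ : ℝ := ℓ / Lq with hC₀
      have hC₀C : C ≤ C₀ := by rw [hC₀, le_div_iff₀ hLq0]; linarith
      have hC₀0 : 0 < C₀ := by linarith
      have hcℓ : c * ℓ / Lq = c * C₀ := by rw [hC₀]; ring
      rw [hcℓ]
      have h1 : 1 - a / C ≤ 1 - a / C₀ := by
        have : a / C₀ ≤ a / C := div_le_div_of_nonneg_left ha0 hC0 hC₀C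
        linarith
      have h2 : c * C₀ ≤ c' / 3 * (1 - a / C) * C₀ := mul_le_mul_of_nonneg_right hcle hC₀0.le
      have h3 : c' / 3 * (1 - a / C) * C₀ ≤ c' / 3 * (1 - a / C₀) * C₀ := by
        have : 0 ≤ c' / 3 * C₀ := by positivity
        nlinarith
      have h4 : c' / 3 * (1 - a / C₀) * C₀ = c' / 3 * (C₀ - a) := by
        field_simp
      linarith
    have hlog : Real.log x / Real.log (x / B) ≤ C / (C - a) := by
      rw [hB]; exact log_div_log_le hq1 ha0 haC hxC.le
    have hlog0 : 0 ≤ Real.log x / Real.log (x / B) := by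
      have : 1 < x / B := by rw [lt_div_iff₀ (by linarith)]; linarith
      exact div_nonneg (Real.log_nonneg hx1.le) (Real.log_nonneg this.le)
    have hCa : 0 < C - a := by linarith
    rw [rpow_one_sub_div_eq hx]
    calc 4 * (x * (Real.exp 1 * D * (B / x) ^ ηM * (Real.log x / Real.log (x / B))))
        = 4 * x * (Real.exp 1 * D) * ((B / x) ^ ηM * (Real.log x / Real.log (x / B))) := by ring
      _ ≤ 4 * x * (Real.exp 1 * D) * (Real.exp (-(c * ℓ / Lq)) * (C / (C - a))) := by
          refine mul_le_mul_of_nonneg_left ?_ (by positivity)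
          rw [hBx']
          exact mul_le_mul hexp hlog hlog0 (Real.exp_pos _).le
      _ = 8 * (Real.exp 1 * KJ * C / (2 * (C - a))) * (x * Real.exp (-(c * ℓ / Lq)) * ((1 - β) * Lq)) := by
          rw [hD]; field_simp; ring
  linarith [hPS]

/-- **The zeros `ρ ≠ β`, `|γ| ≤ T = qℓ³`, in the regime `ℓ > κ(log q)²`**: no density estimate is
needed — with the trivial density (`B = 1`, `D = N(T, χ) ≤ C_b T log T`) and the zero-free strip
`Re ρ ≤ 1 − c'/(3 log T)` the partial summation gives `4 ∑' m(ρ) x^{Re ρ} ≤ 2x/(qℓ)`, both when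
`ℓ ≤ q` (`x^{c'/(12 log q)} ≥ q^{c'κ/12} ≥ q⁷`) and when `ℓ > q` (`e^{c'ℓ/(12 log ℓ)} ≥ 16eC_b ℓ⁷`).
[cite: Bombieri1987GrandCrible, §6 Preuve du Théorème de Linnik, p. 55] -/
theorem zeroSum_le_regimeZ (hχ : χ ≠ 1) {β x ℓ Lq T c' κ Cb : ℝ}
    (hx : x = Real.exp ℓ) (hLq : Lq = Real.log q) (hq3 : (3 : ℝ) ≤ q) (hT : T = q * ℓ ^ 3)
    (hℓ18 : 18 ≤ ℓ) (hqℓ : (q : ℝ) ≤ Real.exp (ℓ / 9)) (hlogℓ : Real.log ℓ ≤ ℓ / 4)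
    (hκℓ : κ * Lq ^ 2 ≤ ℓ) (hκ : 84 ≤ c' * κ) (hc' : 0 < c') (hc'1 : c' ≤ 1) (hCb : 0 ≤ Cb)
    (hZFR : ∀ ρ ∈ lfunctionZeroBox χ T, ρ ≠ (β : ℂ) → ρ.re ≤ 1 - c' / (3 * Real.log (max (q : ℝ) T)))
    (hcount : ∀ P : Finset ℂ, (∀ ρ ∈ P, ρ ∈ lfunctionZeroBox χ T) →
      ∑ ρ ∈ P, (DirichletDisc.zeroOrder χ ρ : ℝ) ≤ Cb * T * Real.log T)
    (ht1 : 4 * Cb * ℓ ^ 5 ≤ Real.exp (5 / 18 * ℓ))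
    (ht2a : 16 * Real.exp 1 * Cb * Lq ≤ q)
    (ht2b : (q : ℝ) < ℓ → 16 * Real.exp 1 * Cb * ℓ ^ 7 * Real.exp (-(c' / 12 * ℓ / Real.log ℓ)) ≤ 1) :
    4 * charZeroPowerSum χ x T {(β : ℂ)} ≤ x / (q * ℓ) + x / (q * ℓ) := by
  classical
  have hq0 : (0 : ℝ) < q := by linarith
  have hq1 : (1 : ℝ) < q := by linarith
  have hLq0 : 0 < Lq := by rw [hLq]; exact Real.log_pos hq1
  have hℓ0 : 0 < ℓ := by linarith
  have hℓ1 : 1 < ℓ := by linarith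
  have hx0 : 0 < x := by rw [hx]; exact Real.exp_pos ℓ
  have hx1 : 1 < x := by rw [hx]; have := Real.add_one_lt_exp hℓ0.ne'; linarith
  have hlogx : Real.log x = ℓ := by rw [hx, Real.log_exp]
  have hT0 : 0 < T := by rw [hT]; positivity
  have hqT : (q : ℝ) ≤ T := by
    rw [hT]; exact le_mul_of_one_le_right hq0.le (one_le_pow₀ hℓ1.le)
  have hT3 : 3 ≤ T := hq3.trans hqT
  have hlogT0 : 0 < Real.log T := Real.log_pos (by linarith)
  have hlogℓ0 : 0 < Real.log ℓ := Real.log_pos hℓ1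
  have hLqℓ : Lq ≤ ℓ / 9 := by
    rw [hLq, ← Real.log_exp (ℓ / 9)]; exact Real.log_le_log hq0 hqℓ
  have hlogT : Real.log T = Lq + 3 * Real.log ℓ := by
    rw [hT, Real.log_mul hq0.ne' (by positivity), Real.log_pow, hLq]; push_cast; ring
  have hlogTℓ : Real.log T ≤ ℓ := by rw [hlogT]; linarith
  -- Bombieri's partial summation with the trivial density
  set N : ℝ := Cb * T * Real.log T with hN
  set ηZ : ℝ := c' / (3 * Real.log T) with hηZ
  have hN0 : 0 ≤ N := by rw [hN]; positivity
  have hmax : max (q : ℝ) T = T := max_eq_right hqT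
  have hηZ0 : 0 < ηZ := by rw [hηZ]; positivity
  have hηhalf : ηZ ≤ 1 / 2 := by
    rw [hηZ, div_le_iff₀ (by positivity)]
    have : Real.log 3 ≤ Real.log T := Real.log_le_log (by norm_num) hT3
    have h3 : 1 ≤ Real.log 3 := by
      rw [← Real.log_exp 1]
      refine Real.log_le_log (Real.exp_pos 1) ?_
      have := Real.exp_one_lt_d9; norm_num at this; linarith
    linarith
  have hre : ∀ ρ ∈ lfunctionZeroBox χ T, ρ ∉ ({(β : ℂ)} : Finset ℂ) → ρ.re ≤ 1 - ηZ := by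
    intro ρ hρ hρβ
    have h := hZFR ρ hρ (by simpa using hρβ)
    rwa [hmax] at h
  have hNbox := hcount (lfunctionZeroBox_finite hχ T).toFinset (fun ρ hρ => by
    rwa [Set.Finite.mem_toFinset] at hρ)
  have hdens' : ∀ α : ℝ, 1 / 2 ≤ α → α ≤ 1 - ηZ →
      charZeroCount χ α T {(β : ℂ)} ≤ N * (1 : ℝ) ^ (1 - α) := by
    intro α _ _
    rw [Real.one_rpow, mul_one]
    exact (charZeroCount_le_sum hχ α T _).trans hNbox
  have hPS := charZeroPowerSum_le_of_count hχ (x := x) (T := T) {(β : ℂ)} le_rfl hx1 hN0 hηhalf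
    hre hdens' hNbox
  rw [div_one, hlogx, div_self hℓ0.ne', mul_one] at hPS
  -- `hPS : PS ≤ x^{1/2} N + x (e N (1/x)^{η})`… the shape after rewriting:
  -- (i) `4 x^{1/2} N ≤ x/(qℓ)`
  have hq2 : (q : ℝ) ^ 2 ≤ Real.exp (2 * ℓ / 9) := by
    have : Real.exp (2 * ℓ / 9) = Real.exp (ℓ / 9) ^ 2 := by
      rw [← Real.exp_nat_mul]; push_cast; ring_nf
    rw [this]; exact pow_le_pow_left₀ hq0.le hqℓ 2
  have hNle : N * (q * ℓ) ≤ Cb * q ^ 2 * ℓ ^ 5 := by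
    rw [hN, hT]
    calc Cb * (q * ℓ ^ 3) * Real.log (q * ℓ ^ 3) * (q * ℓ) ≤ Cb * (q * ℓ ^ 3) * ℓ * (q * ℓ) := by
          rw [← hT]; gcongr
      _ = Cb * q ^ 2 * ℓ ^ 5 := by ring
  have hi : 4 * (x ^ (1 / 2 : ℝ) * N) ≤ x / (q * ℓ) := by
    rw [le_div_iff₀ (by positivity)]
    have hxx : x ^ (1 / 2 : ℝ) * x ^ (1 / 2 : ℝ) = x := by
      rw [← Real.rpow_add hx0]; norm_num
    have hhalf : x ^ (1 / 2 : ℝ) = Real.exp (ℓ / 2) := by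
      rw [hx, ← Real.exp_mul]; ring_nf
    have hkey : 4 * N * (q * ℓ) ≤ x ^ (1 / 2 : ℝ) := by
      calc 4 * N * (q * ℓ) = 4 * (N * (q * ℓ)) := by ring
        _ ≤ 4 * (Cb * q ^ 2 * ℓ ^ 5) := by linarith
        _ = (4 * Cb * ℓ ^ 5) * q ^ 2 := by ring
        _ ≤ Real.exp (5 / 18 * ℓ) * Real.exp (2 * ℓ / 9) :=
            mul_le_mul ht1 hq2 (by positivity) (Real.exp_pos _).le
        _ = Real.exp (ℓ / 2) := by rw [← Real.exp_add]; ring_nf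
        _ = x ^ (1 / 2 : ℝ) := hhalf.symm
    calc 4 * (x ^ (1 / 2 : ℝ) * N) * (q * ℓ) = x ^ (1 / 2 : ℝ) * (4 * N * (q * ℓ)) := by ring
      _ ≤ x ^ (1 / 2 : ℝ) * x ^ (1 / 2 : ℝ) := mul_le_mul_of_nonneg_left hkey (by positivity)
      _ = x := hxx
  -- (ii) `4 e N x (1/x)^{η} ≤ x/(qℓ)`, i.e. `4 e N q ℓ ≤ x^{η}`
  have hii : 4 * (x * (Real.exp 1 * N * (1 / x) ^ ηZ)) ≤ x / (q * ℓ) := by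
    have hxη : (1 / x) ^ ηZ = (x ^ ηZ)⁻¹ := by
      rw [one_div, Real.inv_rpow hx0.le]
    have hxη' : x ^ ηZ = Real.exp (ηZ * ℓ) := by rw [hx, ← Real.exp_mul]; ring_nf
    have hxη0 : 0 < x ^ ηZ := Real.rpow_pos_of_pos hx0 _
    rw [le_div_iff₀ (by positivity), hxη]
    -- suffices: `4 e N q ℓ ≤ x^{η}`
    suffices hkey : 4 * Real.exp 1 * N * (q * ℓ) ≤ x ^ ηZ by
      calc 4 * (x * (Real.exp 1 * N * (x ^ ηZ)⁻¹)) * (q * ℓ)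
          = x * ((4 * Real.exp 1 * N * (q * ℓ)) * (x ^ ηZ)⁻¹) := by ring
        _ ≤ x * (x ^ ηZ * (x ^ ηZ)⁻¹) := by
            refine mul_le_mul_of_nonneg_left ?_ hx0.le
            exact mul_le_mul_of_nonneg_right hkey (inv_nonneg.2 hxη0.le)
        _ = x := by rw [mul_inv_cancel₀ hxη0.ne', mul_one]
    rw [hxη']
    rcases le_or_gt ℓ q with hcase | hcase
    · -- `ℓ ≤ q`: `log T ≤ 4 log q`, `x^{η} ≥ q^{c'κ/12} ≥ q⁷ ≥ 16 e C_b q⁶ log q`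
      have hlogℓq : Real.log ℓ ≤ Lq := by rw [hLq]; exact Real.log_le_log hℓ0 hcase
      have hlogT4 : Real.log T ≤ 4 * Lq := by rw [hlogT]; linarith
      have hqexp : (q : ℝ) = Real.exp Lq := by rw [hLq, Real.exp_log hq0]
      have hexp : Real.exp (7 * Lq) ≤ Real.exp (ηZ * ℓ) := by
        rw [Real.exp_le_exp, hηZ]
        rw [div_mul_eq_mul_div, le_div_iff₀ (by positivity)]
        -- `7 L · 3 log T ≤ 84 L² ≤ c' κ L² ≤ c' ℓ`
        calc 7 * Lq * (3 * Real.log T) ≤ 7 * Lq * (3 * (4 * Lq)) := by gcongr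
          _ = 84 * Lq ^ 2 := by ring
          _ ≤ (c' * κ) * Lq ^ 2 := by gcongr
          _ = c' * (κ * Lq ^ 2) := by ring
          _ ≤ c' * ℓ := mul_le_mul_of_nonneg_left hκℓ hc'.le
      refine le_trans ?_ hexp
      calc 4 * Real.exp 1 * N * (q * ℓ) = 4 * Real.exp 1 * (Cb * (q * ℓ ^ 3) * Real.log T) * (q * ℓ) := by
            rw [hN, hT]
        _ ≤ 4 * Real.exp 1 * (Cb * (q * q ^ 3) * (4 * Lq)) * (q * q) := by gcongr
        _ = (16 * Real.exp 1 * Cb * Lq) * q ^ 6 := by ring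
        _ ≤ q * q ^ 6 := mul_le_mul_of_nonneg_right ht2a (by positivity)
        _ = Real.exp (7 * Lq) := by rw [hqexp, ← Real.exp_nat_mul, ← Real.exp_add]; push_cast; ring_nf
    · -- `ℓ > q`: `log T ≤ 4 log ℓ`, `x^{η} ≥ e^{c'ℓ/(12 log ℓ)} ≥ 16 e C_b ℓ⁷`
      have hLqℓ' : Lq ≤ Real.log ℓ := by rw [hLq]; exact Real.log_le_log hq0 hcase.le
      have hlogT4 : Real.log T ≤ 4 * Real.log ℓ := by rw [hlogT]; linarith
      have hb := ht2b hcase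
      have hexp : Real.exp (c' / 12 * ℓ / Real.log ℓ) ≤ Real.exp (ηZ * ℓ) := by
        rw [Real.exp_le_exp, hηZ]
        have h3T : 3 * Real.log T ≤ 12 * Real.log ℓ := by linarith
        calc c' / 12 * ℓ / Real.log ℓ = c' * ℓ / (12 * Real.log ℓ) := by field_simp
          _ ≤ c' * ℓ / (3 * Real.log T) :=
              div_le_div_of_nonneg_left (by positivity) (by positivity) h3T
          _ = c' / (3 * Real.log T) * ℓ := by ring
      refine le_trans ?_ hexp
      have hpos : 0 < Real.exp (c' / 12 * ℓ / Real.log ℓ) := Real.exp_pos _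
      have hb' : 16 * Real.exp 1 * Cb * ℓ ^ 7 ≤ Real.exp (c' / 12 * ℓ / Real.log ℓ) := by
        have := mul_le_mul_of_nonneg_right hb hpos.le
        rwa [mul_assoc, ← Real.exp_add, neg_add_cancel, Real.exp_zero, mul_one, one_mul] at this
      refine le_trans ?_ hb'
      have hlogℓℓ : Real.log ℓ ≤ ℓ := by linarith
      calc 4 * Real.exp 1 * N * (q * ℓ) = 4 * Real.exp 1 * (Cb * (q * ℓ ^ 3) * Real.log T) * (q * ℓ) := by
            rw [hN, hT]
        _ ≤ 4 * Real.exp 1 * (Cb * (ℓ * ℓ ^ 3) * (4 * Real.log ℓ)) * (ℓ * ℓ) := by gcongr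
        _ ≤ 4 * Real.exp 1 * (Cb * (ℓ * ℓ ^ 3) * (4 * ℓ)) * (ℓ * ℓ) := by gcongr
        _ = 16 * Real.exp 1 * Cb * ℓ ^ 7 := by ring
  linarith [hPS]

end Regimes


/-! ## (3.3) from Theorem J -/

set_option maxHeartbeats 4000000 in
/-- **Granville–Mollin 2000, (3.3), from the low-height log-free density estimate with the
Deuring–Heilbronn factor.** Suppose ("Theorem J", Heath-Brown 1992 §§11–13 / Jutila 1977 Thm 2 for
one modulus, in `q`-units): there are `λ* > 0`, `0 < θ₁ ≤ 1`, `0 ≤ a < 9`, `K_J ≥ 0`, `q_J` such that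
for every primitive quadratic `χ` mod `q ≥ q_J` and every real zero `β₁ ≥ 1 − λ*/log q` of `L(s, χ)`,
`N(α, q^{θ₁}; χ, {β₁}) ≤ K_J ((1 − β₁) log q) q^{a(1 − α)}` for `1/2 ≤ α ≤ 1`. Then
`Literature.NumberTheory.LFunctions.SiegelZero.GranvilleMollin2000_eq33` holds: for every `C > 9`
there are `c > 0`, `K`, `η₀`, `q₀` with
`|θ(x, χ) + x^{β}/β| ≤ K (x/(q log x) + x^{1 − c/log q}/η)` for `x > q^C`, `β = 1 − 1/(η log q)`,
`η ≥ η₀`, `q ≥ q₀`. (Montgomery–Vaughan's explicit formula `truncatedExplicitFormula_psiChar_holds`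
truncated at `T = q^{θ₁}` when `log x ≤ κ log² q` and at `T = q log³ x` otherwise; Siegel's theorem
for `1 − β ≥ C_S q^{−θ₁/4}`; see the module docstring.)
[cite: GranvilleMollin2000, §3 (3.1)–(3.3)] [cite: Bombieri1987GrandCrible, §6 Théorème 14 and pp. 54–55] -/
theorem GranvilleMollin2000_eq33_of_dhDensity
    (hJ : ∃ lamStar θ₁ a KJ qJ : ℝ, 0 < lamStar ∧ 0 < θ₁ ∧ θ₁ ≤ 1 ∧ 0 ≤ a ∧ a < 9 ∧ 0 ≤ KJ ∧
      ∀ (q : ℕ) [NeZero q] (χ : DirichletCharacter ℂ q), χ.IsPrimitive → χ.IsQuadratic →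
        qJ ≤ (q : ℝ) → ∀ β₁ : ℝ, χ.LFunction β₁ = 0 → 1 - lamStar / Real.log q ≤ β₁ →
          ∀ α : ℝ, 1 / 2 ≤ α → α ≤ 1 →
            charZeroCount χ α ((q : ℝ) ^ θ₁) {(β₁ : ℂ)} ≤
              KJ * ((1 - β₁) * Real.log q) * (q : ℝ) ^ (a * (1 - α))) :
    GranvilleMollin2000_eq33 := by
  classical
  intro C hC
  obtain ⟨lamStar, θ₁, a, KJ, qJ, hlam, hθ₁, hθ₁1, ha0, ha9, hKJ, hJ'⟩ := hJ
  have hC0 : 0 < C := by linarith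
  have haC : a < C := by linarith
  have hCa : 0 < C - a := by linarith
  /- ### constants from the tree -/
  obtain ⟨K₁, hK₁⟩ := truncatedExplicitFormula_psiChar_holds 2 one_lt_two
  obtain ⟨c₄, hc₄, hsimple⟩ := exists_deriv_ne_zero_of_realZero
  obtain ⟨c₀, hc₀, hsmall⟩ := exists_re_ge_of_smallZero
  obtain ⟨KD, hKDpos, hJensen⟩ :=
    DirichletDisc.exists_sum_zeroOrder_le_of_subset_closedBall (R := 13 / 10) (by norm_num)
      (by norm_num)
  have hKD : 0 ≤ KD := hKDpos.le
  obtain ⟨CS, hCS, hSiegel⟩ :=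
    Literature.NumberTheory.LFunctions.Siegel.exists_one_sub_realZero_ge (ε := 1) one_pos
  obtain ⟨CS₂, hCS₂, hSiegel₂⟩ :=
    Literature.NumberTheory.LFunctions.Siegel.exists_one_sub_realZero_ge (ε := θ₁ / 4) (by positivity)
  obtain ⟨cE, hcE, C₅, hC₅, hConst⟩ := exists_norm_explicitFormulaConst_le
  obtain ⟨c'', hc''pos, hZFR''⟩ := exists_re_le_of_ne_realZero
  obtain ⟨Cb, hCb, hbox⟩ := exists_boxCount_le
  obtain ⟨Cw, hCw, hboxle⟩ := exists_boxCount_le_of_le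
  /- ### the constants of the proof -/
  obtain ⟨c', hc'def⟩ : ∃ c' : ℝ, c' = min c'' 1 := ⟨_, rfl⟩
  have hc' : 0 < c' := by rw [hc'def]; exact lt_min hc''pos one_pos
  have hc'1 : c' ≤ 1 := by rw [hc'def]; exact min_le_right _ _
  have hc'le : c' ≤ c'' := by rw [hc'def]; exact min_le_left _ _
  obtain ⟨κ, hκdef⟩ : ∃ κ : ℝ, κ = 84 / c' + 1 := ⟨_, rfl⟩
  have hκ0 : 0 < κ := by rw [hκdef]; positivity
  have hκ84 : 84 ≤ c' * κ := by
    rw [hκdef, mul_add, mul_div_cancel₀ _ hc'.ne']; linarith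
  obtain ⟨K₁', hK₁'⟩ : ∃ K : ℝ, K = max K₁ 0 := ⟨_, rfl⟩
  have hK₁'0 : 0 ≤ K₁' := by rw [hK₁']; exact le_max_right _ _
  have hK₁le : K₁ ≤ K₁' := by rw [hK₁']; exact le_max_left _ _
  have haC1 : 0 < 1 - a / C := by rw [sub_pos, div_lt_one hC0]; exact haC
  obtain ⟨c, hcdef⟩ : ∃ c : ℝ, c = min (θ₁ / (8 * κ)) (c' / 3 * (1 - a / C)) := ⟨_, rfl⟩
  have hc : 0 < c := by rw [hcdef]; exact lt_min (by positivity) (by positivity)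
  have hcκ : c * κ ≤ θ₁ / 8 := by
    have : c ≤ θ₁ / (8 * κ) := by rw [hcdef]; exact min_le_left _ _
    rw [le_div_iff₀ (by positivity)] at this; linarith
  have hcle : c ≤ c' / 3 * (1 - a / C) := by rw [hcdef]; exact min_le_right _ _
  obtain ⟨K₂, hK₂def⟩ : ∃ K₂ : ℝ, K₂ = Real.exp 1 * KJ * C / (2 * (C - a)) := ⟨_, rfl⟩
  have hK₂0 : 0 ≤ K₂ := by rw [hK₂def]; positivity
  /- ### thresholds -/
  obtain ⟨C', hC'def⟩ : ∃ C' : ℝ, C' = (9 + C) / 2 := ⟨_, rfl⟩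
  have hC'9 : 9 < C' := by rw [hC'def]; linarith
  have hC'C : C' < C := by rw [hC'def]; linarith
  obtain ⟨L₀, hL₀, hthr⟩ :=
    exists_linnikRange_threshold C C' K₁' 0 CS KD c₀ C₅ 1 0 hC'C hC'9 one_pos
  obtain ⟨t₁, -, ht₁⟩ := exists_mul_pow_le_exp (4 * κ ^ 2 / CS₂) 3 (5 * θ₁ / 8) (by positivity)
  obtain ⟨t₂, -, ht₂⟩ := exists_mul_pow_le_exp (4 * Cw * κ) 3 (5 / 2) (by norm_num)
  obtain ⟨t₃, -, ht₃⟩ := exists_mul_pow_le_exp (4 * Cb) 5 (5 / 18) (by norm_num)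
  obtain ⟨t₄, -, ht₄⟩ := exists_mul_pow_le_exp (16 * Real.exp 1 * Cb) 1 1 one_pos
  obtain ⟨ℓ₁, -, hℓ₁⟩ :=
    exists_mul_pow_mul_exp_neg_div_log_le_one (16 * Real.exp 1 * Cb) 7 (a := c' / 12)
      (by positivity)
  obtain ⟨Lth, hLth⟩ : ∃ Lth : ℝ,
      Lth = max (max (max L₀ t₁) (max t₂ (2 / θ₁ + 1))) (max t₃ t₄) := ⟨_, rfl⟩
  obtain ⟨η₀, hη₀⟩ : ∃ η₀ : ℝ,
      η₀ = max (max 9 (1 / lamStar)) (max (max (3 / c₄) (3 / c₀)) (max (3 / cE) (3 / c'))) :=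
    ⟨_, rfl⟩
  refine ⟨c, hc, 9 * K₁' + 8 * K₂ + 8, η₀, max (Real.exp Lth) (max qJ ℓ₁), ?_⟩
  intro q _ hsqf hq4 hqq₀ χ hprim hquad η hη hLβ x hx
  /- ### Step 0: sizes of `q`, `η`, `x` -/
  have hq3n : 3 ≤ q := by omega
  have hq3 : (3 : ℝ) ≤ q := by exact_mod_cast hq3n
  have hq1 : (1 : ℝ) ≤ q := by linarith
  have hq1' : (1 : ℝ) < q := by linarith
  have hq0 : (0 : ℝ) < q := by linarith
  have hq1n : 1 < q := by omega
  have hqodd : Odd q := Nat.odd_iff.2 (by omega)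
  have hχ1 : χ ≠ 1 := by
    intro h
    have : χ.conductor = 1 := by rw [h, DirichletCharacter.conductor_one]
    rw [hprim] at this
    omega
  have hχ2 : χ ^ 2 = 1 := hquad.sq_eq_one
  obtain ⟨Lq, hLqdef⟩ : ∃ L : ℝ, L = Real.log q := ⟨_, rfl⟩
  have hlogq1 : 1 < Lq := by
    rw [hLqdef, ← Real.log_exp 1]
    refine Real.log_lt_log (Real.exp_pos 1) (lt_of_lt_of_le ?_ hq3)
    have := Real.exp_one_lt_d9; norm_num at this; linarith
  have hLq0 : 0 < Lq := by linarith
  have hLq1 : 1 ≤ Lq := hlogq1.le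
  have hqexp : (q : ℝ) = Real.exp Lq := by rw [hLqdef, Real.exp_log hq0]
  -- thresholds in `q`
  have hqLth : Lth ≤ Lq := by
    have h : Real.exp Lth ≤ q := (le_max_left _ _).trans hqq₀
    rw [hLqdef, ← Real.log_exp Lth]; exact Real.log_le_log (Real.exp_pos _) h
  have hqJ : qJ ≤ q := ((le_max_left _ _).trans (le_max_right _ _)).trans hqq₀
  have hqℓ₁ : ℓ₁ ≤ q := ((le_max_right _ _).trans (le_max_right _ _)).trans hqq₀
  rw [hLth] at hqLth
  have hL₀Lq : L₀ ≤ Lq :=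
    ((le_max_left _ _).trans ((le_max_left _ _).trans (le_max_left _ _))).trans hqLth
  have ht₁Lq : t₁ ≤ Lq :=
    ((le_max_right _ _).trans ((le_max_left _ _).trans (le_max_left _ _))).trans hqLth
  have ht₂Lq : t₂ ≤ Lq :=
    ((le_max_left _ _).trans ((le_max_right _ _).trans (le_max_left _ _))).trans hqLth
  have hθLq : 2 / θ₁ + 1 ≤ Lq :=
    ((le_max_right _ _).trans ((le_max_right _ _).trans (le_max_left _ _))).trans hqLth
  have ht₃Lq : t₃ ≤ Lq := ((le_max_left _ _).trans (le_max_right _ _)).trans hqLth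
  have ht₄Lq : t₄ ≤ Lq := ((le_max_right _ _).trans (le_max_right _ _)).trans hqLth
  -- `η`
  have hη9 : 9 ≤ η := le_trans (by rw [hη₀]; exact (le_max_left _ _).trans (le_max_left _ _)) hη
  have hη0 : 0 < η := by linarith
  have hηlam : 1 / lamStar ≤ η :=
    le_trans (by rw [hη₀]; exact (le_max_right _ _).trans (le_max_left _ _)) hη
  have hηc₄ : 3 / c₄ ≤ η := le_trans (by
    rw [hη₀]; exact (le_max_left _ _).trans ((le_max_left _ _).trans (le_max_right _ _))) hη
  have hηc₀ : 3 / c₀ ≤ η := le_trans (by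
    rw [hη₀]; exact (le_max_right _ _).trans ((le_max_left _ _).trans (le_max_right _ _))) hη
  have hηcE : 3 / cE ≤ η := le_trans (by
    rw [hη₀]; exact (le_max_left _ _).trans ((le_max_right _ _).trans (le_max_right _ _))) hη
  have hηc' : 3 / c' ≤ η := le_trans (by
    rw [hη₀]; exact (le_max_right _ _).trans ((le_max_right _ _).trans (le_max_right _ _))) hη
  -- `β`
  obtain ⟨β, hβdef⟩ : ∃ β : ℝ, β = 1 - 1 / (η * Real.log q) := ⟨_, rfl⟩
  rw [← hβdef] at hLβ ⊢
  have h1β : 1 - β = 1 / (η * Lq) := by rw [hβdef, hLqdef]; ring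
  have h1β0 : 0 < 1 - β := by rw [h1β]; positivity
  have hβ1 : β < 1 := by linarith
  have hP1 : (1 - β) * Lq = 1 / η := by rw [h1β]; field_simp
  have hν9 : 1 - β ≤ 1 / 9 := by
    rw [h1β]
    refine one_div_le_one_div_of_le (by norm_num) ?_
    calc (9 : ℝ) = 9 * 1 := by norm_num
      _ ≤ η * Lq := mul_le_mul hη9 hLq1 zero_le_one hη0.le
  have hβhalf : 1 / 2 < β := by linarith
  have hβ0 : χ.LFunction β = 0 := hLβ
  have hβk : ∀ k : ℝ, 0 < k → 3 / k ≤ η → 1 - k / (Real.log q + Real.log 4) < β := by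
    intro k hk hηk
    have := inv_eta_log_lt hk hηk hq3
    rw [hβdef]; linarith
  have hβlam : 1 - lamStar / Real.log q ≤ β := by
    rw [hβdef, ← hLqdef]
    have : 1 / (η * Lq) ≤ lamStar / Lq := by
      rw [show 1 / (η * Lq) = (1 / η) / Lq by field_simp]
      refine div_le_div_of_nonneg_right ?_ hLq0.le
      rw [div_le_iff₀ hη0]
      have := (div_le_iff₀ hlam).1 hηlam
      linarith
    linarith
  -- `x`, `ℓ`
  have hqC1 : (1 : ℝ) ≤ (q : ℝ) ^ C := Real.one_le_rpow hq1 hC0.le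
  have hx1 : 1 < x := lt_of_le_of_lt hqC1 hx
  have hx0 : 0 < x := by linarith
  obtain ⟨ℓ, hℓdef⟩ : ∃ ℓ : ℝ, ℓ = Real.log x := ⟨_, rfl⟩
  have hxℓ : x = Real.exp ℓ := by rw [hℓdef, Real.exp_log hx0]
  have hCℓ : C * Lq < ℓ := by
    rw [hℓdef, hLqdef, ← Real.log_rpow hq0]; exact Real.log_lt_log (by positivity) hx
  have h9Lq : 9 * Lq ≤ C * Lq := mul_le_mul_of_nonneg_right hC.le hLq0.le
  have hLqℓ : Lq ≤ ℓ := by linarith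
  have hLqℓ9 : Lq ≤ ℓ / 9 := by rw [le_div_iff₀ (by norm_num)]; linarith
  have hlogq9 : Real.log q ≤ ℓ / 9 := by rw [← hLqdef]; exact hLqℓ9
  have hL₀ℓ : L₀ ≤ ℓ := hL₀Lq.trans hLqℓ
  have hℓ18 : 18 ≤ ℓ := hL₀.trans hL₀ℓ
  have hℓ1 : 1 ≤ ℓ := by linarith
  have hℓ0 : 0 < ℓ := by linarith
  have hqℓ : (q : ℝ) ≤ Real.exp (ℓ / 9) := by rw [hqexp]; exact Real.exp_le_exp.2 hLqℓ9
  have hx2 : (2 : ℝ) ≤ x := by rw [hxℓ]; have := Real.add_one_le_exp ℓ; linarith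
  obtain ⟨-, -, hI3, hI4, hI5, hI6, -, -, hI9, hI10⟩ := hthr ℓ hL₀ℓ
  /- ### Step 1: the zeros `β`, `1 − β`, and the zero-free strip -/
  have hmβ : DirichletDisc.zeroOrder χ β = 1 :=
    zeroOrder_eq_one_of_deriv_ne_zero hχ1 hβ0 (hsimple q χ hχ1 β hβ0 (hβk c₄ hc₄ hηc₄))
  have hJD : ∀ S : Finset ℂ,
      (∀ u ∈ S, u ∈ closedBall (2 + ((0 : ℝ) : ℂ) * I) (13 / 10) ∧ χ.LFunction u = 0) →
        (∑ ρ ∈ S, (DirichletDisc.zeroOrder χ ρ : ℝ)) ≤ KD * (Real.log q + Real.log 4) := by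
    intro S hS
    have := hJensen q χ hχ1 0 S hS
    rwa [abs_zero, zero_add] at this
  have hlog5 : 0 < Real.log 5 := Real.log_pos (by norm_num)
  have hlogq0' : 0 < Real.log q := by rw [← hLqdef]; exact hLq0
  have hr₀ : 0 < c₀ / (Real.log q + Real.log 5) := by positivity
  have hβc'' : 1 - c'' / Real.log (2 * q) < β := by
    have h := hβk c' hc' hηc'
    have hle : c' / (Real.log q + Real.log 4) ≤ c'' / Real.log (2 * q) := by
      rw [Real.log_mul (by norm_num) hq0.ne']
      have hlog2 : 0 < Real.log 2 := Real.log_pos (by norm_num)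
      have hpos : 0 < Real.log 2 + Real.log q := by positivity
      calc c' / (Real.log q + Real.log 4) ≤ c' / (Real.log 2 + Real.log q) := by
            refine div_le_div_of_nonneg_left hc'.le hpos ?_
            have : Real.log 2 ≤ Real.log 4 := Real.log_le_log (by norm_num) (by norm_num)
            linarith
        _ ≤ c'' / (Real.log 2 + Real.log q) := div_le_div_of_nonneg_right hc'le hpos.le
    linarith
  have hZFR : ∀ T : ℝ, 3 ≤ T → ∀ ρ ∈ lfunctionZeroBox χ T, ρ ≠ (β : ℂ) →
      ρ.re ≤ 1 - c' / (3 * Real.log (max (q : ℝ) T)) := by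
    intro T hT ρ hρ hne
    have h := hZFR'' q χ hχ1 hq3 β hβ0 hβc'' T hT ρ hρ hne
    have hM : 1 < max (q : ℝ) T := lt_of_lt_of_le hq1' (le_max_left _ _)
    have hlogM : 0 < Real.log (max (q : ℝ) T) := Real.log_pos hM
    have : c' / (3 * Real.log (max (q : ℝ) T)) ≤ c'' / (3 * Real.log (max (q : ℝ) T)) :=
      div_le_div_of_nonneg_right hc'le (by positivity)
    linarith
  -- Siegel
  have hS : 1 / (1 - β) ≤ q / CS := by
    have h := hSiegel q χ hχ2 hχ1 β hβ0
    rw [Real.rpow_neg hq0.le, Real.rpow_one] at h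
    rw [div_le_div_iff₀ h1β0 hCS]
    calc 1 * CS = CS * (q : ℝ)⁻¹ * q := by field_simp
      _ ≤ (1 - β) * q := mul_le_mul_of_nonneg_right h hq0.le
      _ = q * (1 - β) := mul_comm _ _
  have hS₂ : CS₂ * Real.exp (-(θ₁ / 4 * Lq)) ≤ 1 - β := by
    have h := hSiegel₂ q χ hχ2 hχ1 β hβ0
    have : (q : ℝ) ^ (-(θ₁ / 4)) = Real.exp (-(θ₁ / 4 * Lq)) := by
      rw [hqexp, ← Real.exp_mul]; ring_nf
    rwa [this] at h
  /- ### Step 2: `θ` versus `ψ`, `ψ₀`, and `C(χ)`; the pieces of size `≤ X` -/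
  obtain ⟨ψc, hψc⟩ : ∃ z : ℂ, z = chebyshevPsiChar χ x := ⟨_, rfl⟩
  obtain ⟨ψ0, hψ0⟩ : ∃ z : ℂ, z = chebyshevPsiChar₀ χ x := ⟨_, rfl⟩
  obtain ⟨Cχ, hCχ⟩ : ∃ z : ℂ, z = explicitFormulaConst χ := ⟨_, rfl⟩
  obtain ⟨A, hA⟩ : ∃ A : ℂ, A = 1 / 2 * ((Real.log (x - 1) : ℝ) : ℂ) +
      χ (-1) / 2 * ((Real.log (x + 1) : ℝ) : ℂ) := ⟨_, rfl⟩
  have hθψ := abs_jacobiTheta_sub_re_le hqodd hsqf χ hprim hquad hx1.le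
  rw [← hψc, ← hℓdef] at hθψ
  have hψ₀ψ := norm_chebyshevPsiChar₀_sub_le χ hx1.le
  rw [← hψc, ← hψ0, ← hℓdef] at hψ₀ψ
  have hCχ' := hConst q χ hχ1 hquad β hβ0 (hβk cE hcE hηcE)
  rw [← hCχ] at hCχ'
  obtain ⟨mβ, hmβdef⟩ : ∃ m : ℝ, m = x ^ β / β := ⟨_, rfl⟩
  obtain ⟨m₂, hm₂def⟩ : ∃ m : ℝ, m = x ^ (1 - β) / (1 - β) := ⟨_, rfl⟩
  obtain ⟨X, hXdef⟩ : ∃ X : ℝ, X = x / (q * ℓ) := ⟨_, rfl⟩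
  obtain ⟨P, hPdef⟩ : ∃ P : ℝ, P = x ^ (1 - c / Lq) / η := ⟨_, rfl⟩
  have hX0 : 0 ≤ X := by rw [hXdef]; positivity
  have hP0 : 0 ≤ P := by rw [hPdef]; positivity
  have hPeq : x ^ (1 - c / Lq) * ((1 - β) * Lq) = P := by rw [hP1, hPdef]; ring
  rw [← hmβdef, ← hℓdef, ← hLqdef, ← hXdef, ← hPdef]
  have ha : |jacobiTheta q x - ψc.re| ≤ X := by
    rw [hXdef]; exact hθψ.trans (sqrt_term_le hxℓ hq1 hqℓ hℓ1 hI4)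
  have hAn : ‖A‖ ≤ ℓ + 1 / 2 := by rw [hA, hℓdef]; exact norm_trivialTerms_le χ hx2
  have hb : ‖ψc - ψ0‖ + ‖A‖ + K₁' * ℓ ≤ (K₁' + 10) * ℓ := by
    rw [norm_sub_rev] at hψ₀ψ
    linarith
  have hb' : (K₁' + 10) * ℓ ≤ X := by rw [hXdef]; exact linear_term_le hxℓ hq1 hqℓ hℓ1 hI5
  have hm₂ : ‖(m₂ : ℂ)‖ ≤ X := by
    have hm₂0 : 0 ≤ m₂ := by rw [hm₂def]; positivity
    rw [Complex.norm_real, Real.norm_of_nonneg hm₂0, hm₂def, hXdef]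
    calc x ^ (1 - β) / (1 - β) = x ^ (1 - β) * (1 / (1 - β)) := by ring
      _ ≤ x ^ (1 - β) * (q / CS) := mul_le_mul_of_nonneg_left hS (Real.rpow_nonneg hx0.le _)
      _ ≤ x / (q * ℓ) := smallPower_term_le hxℓ hq1 hqℓ hℓ1 hν9 hCS hI6
  have hCbd : ‖Cχ‖ ≤ X := by
    rw [hXdef]
    exact hCχ'.trans (const_term_le hxℓ hq1 hqℓ hlogq9 hℓ18 hC₅ h1β0 hS hI10)
  have hsz : x ^ (1 / 4 : ℝ) / (c₀ / (Real.log q + Real.log 5)) * (KD * (Real.log q + Real.log 4)) ≤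
      X := by
    rw [hXdef]; exact smallZeros_term_le hxℓ hq1 hqℓ hlogq9 hℓ18 hKD hc₀ hI9
  /- ### Step 3: the assembly, for a truncation height `T` -/
  have key : ∀ T : ℝ, 0 ≤ T →
      ‖ψ0 - (-charZeroSumTrunc χ x T - A + Cχ)‖ ≤ K₁' * ℓ + 9 * K₁' * X + K₁' * P →
      4 * charZeroPowerSum χ x T {(β : ℂ)} ≤ 2 * X + 8 * K₂ * P →
      |jacobiTheta q x + mβ| ≤ (9 * K₁' + 8 * K₂ + 8) * (X + P) := by
    intro T hT0 hR h4PS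
    obtain ⟨Z, hZ⟩ : ∃ z : ℂ, z = charZeroSumTrunc χ x T := ⟨_, rfl⟩
    rw [← hZ] at hR
    have hZsum := norm_charZeroSumTrunc_sub_le hχ1 hprim hquad hβ0 hβhalf hβ1 hmβ hr₀
      (hsmall q χ hχ1 hprim hquad β hβ0 (hβk c₀ hc₀ hηc₀)) hJD hx1.le hT0
    rw [← hZ, ← hmβdef, ← hm₂def] at hZsum
    obtain ⟨E, hEdef⟩ : ∃ E : ℂ, E = Z - (mβ : ℂ) - (m₂ : ℂ) := ⟨_, rfl⟩
    rw [← hEdef] at hZsum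
    have hid : jacobiTheta q x + mβ =
        (jacobiTheta q x - ψc.re) +
          ((ψc - ψ0) + (ψ0 - (-Z - A + Cχ)) + (-E - (m₂ : ℂ) - A + Cχ)).re := by
      have hcx : (ψc - ψ0) + (ψ0 - (-Z - A + Cχ)) + (-E - (m₂ : ℂ) - A + Cχ) = ψc + (mβ : ℂ) := by
        rw [hEdef]; ring
      rw [hcx, Complex.add_re, Complex.ofReal_re]; ring
    have htri : |jacobiTheta q x + mβ| ≤ |jacobiTheta q x - ψc.re| + ‖ψc - ψ0‖ +
        ‖ψ0 - (-Z - A + Cχ)‖ + (‖E‖ + ‖(m₂ : ℂ)‖ + ‖A‖ + ‖Cχ‖) := by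
      rw [hid]
      refine (abs_add_le _ _).trans ?_
      have hre : |((ψc - ψ0) + (ψ0 - (-Z - A + Cχ)) + (-E - (m₂ : ℂ) - A + Cχ)).re| ≤
          ‖(ψc - ψ0) + (ψ0 - (-Z - A + Cχ)) + (-E - (m₂ : ℂ) - A + Cχ)‖ := Complex.abs_re_le_norm _
      have h3 : ‖(ψc - ψ0) + (ψ0 - (-Z - A + Cχ)) + (-E - (m₂ : ℂ) - A + Cχ)‖ ≤
          ‖ψc - ψ0‖ + ‖ψ0 - (-Z - A + Cχ)‖ + ‖-E - (m₂ : ℂ) - A + Cχ‖ := norm_add₃_le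
      have h4 : ‖-E - (m₂ : ℂ) - A + Cχ‖ ≤ ‖E‖ + ‖(m₂ : ℂ)‖ + ‖A‖ + ‖Cχ‖ := by
        have e1 := norm_add_le (-E - (m₂ : ℂ) - A) Cχ
        have e2 := norm_sub_le (-E - (m₂ : ℂ)) A
        have e3 := norm_sub_le (-E) (m₂ : ℂ)
        rw [norm_neg] at e3
        linarith
      linarith
    have hE : ‖E‖ ≤ 3 * X + 8 * K₂ * P := by linarith [hZsum]
    exact final_combination₂ htri ha hb hb' hm₂ hE hCbd hR hX0 hP0 hK₁'0 hK₂0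
  /- ### Step 4: the two regimes -/
  have hF1nn : ∀ T : ℝ, 0 < T →
      0 ≤ Real.log x * min 1 (x / (T * primePowDist x)) + x / T * Real.log (q * x * T) ^ 2 := by
    intro T hT0
    have : 0 ≤ min 1 (x / (T * primePowDist x)) :=
      le_min zero_le_one (div_nonneg hx0.le (mul_nonneg hT0.le (primePowDist_nonneg x)))
    have : 0 ≤ Real.log x := by rw [← hℓdef]; linarith
    positivity
  have hmin : ∀ T : ℝ, Real.log x * min 1 (x / (T * primePowDist x)) ≤ ℓ := by
    intro T
    rw [← hℓdef]
    calc ℓ * min 1 (x / (T * primePowDist x)) ≤ ℓ * 1 :=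
          mul_le_mul_of_nonneg_left (min_le_left _ _) hℓ0.le
      _ = ℓ := mul_one ℓ
  rcases le_or_gt ℓ (κ * Lq ^ 2) with hM | hZreg
  · /- #### Regime `ℓ ≤ κ L²`: `T = q^{θ₁}` -/
    obtain ⟨T, hTdef⟩ : ∃ T : ℝ, T = (q : ℝ) ^ θ₁ := ⟨_, rfl⟩
    have hTexp : T = Real.exp (θ₁ * Lq) := by
      rw [hTdef, hqexp, ← Real.exp_mul]; ring_nf
    have hθLq2 : 2 ≤ θ₁ * Lq := by
      have h1 : 2 / θ₁ ≤ Lq := by linarith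
      rw [div_le_iff₀ hθ₁] at h1; linarith
    have hT6 : 6 ≤ T := by
      rw [hTexp]
      exact six_le_exp_two.trans (Real.exp_le_exp.2 hθLq2)
    have hT0 : 0 < T := by linarith
    have hT2 : 2 ≤ T := by linarith
    have hT3 : 3 ≤ T := by linarith
    have hTq : T ≤ q := by
      rw [hTdef]
      calc (q : ℝ) ^ θ₁ ≤ (q : ℝ) ^ (1 : ℝ) := Real.rpow_le_rpow_of_exponent_le hq1 hθ₁1
        _ = q := Real.rpow_one _
    -- the explicit formula, truncated at `T`
    have hEF := hK₁ q hq1n χ hprim x hx2 T hT2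
    rw [sub_sub (-charZeroSumTrunc χ x T), ← hA, ← hψ0, ← hCχ] at hEF
    have htrunc : x / T * Real.log (q * x * T) ^ 2 ≤ P := by
      rw [← hPeq]
      exact truncation_term_le_regimeM hxℓ hqexp hTexp hLq1 hLqℓ9 hM hθ₁ hθ₁1 hc.le hcκ hCS₂ hS₂
        (ht₁ Lq ht₁Lq)
    have hR : ‖ψ0 - (-charZeroSumTrunc χ x T - A + Cχ)‖ ≤ K₁' * ℓ + 9 * K₁' * X + K₁' * P := by
      have h2 : Real.log x * min 1 (x / (T * primePowDist x)) + x / T * Real.log (q * x * T) ^ 2 ≤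
          ℓ + P := add_le_add (hmin T) htrunc
      calc ‖ψ0 - (-charZeroSumTrunc χ x T - A + Cχ)‖ ≤ K₁ * _ := hEF
        _ ≤ K₁' * (Real.log x * min 1 (x / (T * primePowDist x)) + x / T * Real.log (q * x * T) ^ 2) :=
            mul_le_mul_of_nonneg_right hK₁le (hF1nn T hT0)
        _ ≤ K₁' * (ℓ + P) := mul_le_mul_of_nonneg_left h2 hK₁'0
        _ = K₁' * ℓ + K₁' * P := by ring
        _ ≤ K₁' * ℓ + 9 * K₁' * X + K₁' * P := by
            have : 0 ≤ K₁' * X := mul_nonneg hK₁'0 hX0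
            linarith
    -- the zeros, from Theorem J
    have hηM : c' / (3 * Lq) ≤ 1 / 2 := by
      rw [div_le_iff₀ (by positivity)]; linarith
    have hdens : ∀ α : ℝ, 1 / 2 ≤ α → α ≤ 1 →
        charZeroCount χ α T {(β : ℂ)} ≤ KJ * ((1 - β) * Lq) * (q : ℝ) ^ (a * (1 - α)) := by
      intro α hα hα1
      rw [hTdef, hLqdef]
      exact hJ' q χ hprim hquad hqJ β hβ0 hβlam α hα hα1
    have hcount : ∀ P : Finset ℂ, (∀ ρ ∈ P, ρ ∈ lfunctionZeroBox χ T) →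
        ∑ ρ ∈ P, (DirichletDisc.zeroOrder χ ρ : ℝ) ≤ Cw * T * Lq := by
      intro P hP
      rw [hLqdef]; exact hboxle q χ hprim hq1n T hT6 hTq P hP
    have ht : 4 * Cw * T * Lq * (q * ℓ) ≤ x ^ (1 / 2 : ℝ) := by
      -- `4 C_w T L q ℓ ≤ 4 C_w κ L³ q² ≤ q^{5/2} q² = q^{9/2} ≤ x^{1/2}`
      have h1 : 4 * Cw * T * Lq * (q * ℓ) ≤ (4 * Cw * κ * Lq ^ 3) * q ^ 2 := by
        calc 4 * Cw * T * Lq * (q * ℓ) ≤ 4 * Cw * q * Lq * (q * (κ * Lq ^ 2)) := by gcongr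
          _ = (4 * Cw * κ * Lq ^ 3) * q ^ 2 := by ring
      have h2 : (4 * Cw * κ * Lq ^ 3) * q ^ 2 ≤ Real.exp (5 / 2 * Lq) * q ^ 2 :=
        mul_le_mul_of_nonneg_right (ht₂ Lq ht₂Lq) (by positivity)
      have h3 : Real.exp (5 / 2 * Lq) * q ^ 2 = (q : ℝ) ^ (9 / 2 : ℝ) := by
        rw [hqexp, ← Real.exp_nat_mul, ← Real.exp_add, ← Real.exp_mul]; push_cast; ring_nf
      have h4 : (q : ℝ) ^ (9 / 2 : ℝ) ≤ x ^ (1 / 2 : ℝ) := by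
        have : (q : ℝ) ^ (9 / 2 : ℝ) = ((q : ℝ) ^ (9 : ℝ)) ^ (1 / 2 : ℝ) := by
          rw [← Real.rpow_mul hq0.le]; norm_num
        rw [this]
        refine Real.rpow_le_rpow (by positivity) ?_ (by norm_num)
        exact (Real.rpow_le_rpow_of_exponent_le hq1 hC.le).trans hx.le
      linarith
    have h4PS := zeroSum_le_regimeM hχ1 hβ1 hxℓ hLqdef hq3 hTq hC ha0 haC hx hc' hcle hηM hKJ
      (hZFR T hT3) hdens hcount ht
    rw [hPeq, ← hK₂def, ← hXdef] at h4PS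
    exact key T hT0.le hR (by linarith)
  · /- #### Regime `ℓ > κ L²`: `T = q ℓ³` -/
    obtain ⟨T, hTdef⟩ : ∃ T : ℝ, T = q * ℓ ^ 3 := ⟨_, rfl⟩
    have hT0 : 0 < T := by rw [hTdef]; positivity
    have hqT : (q : ℝ) ≤ T := by
      rw [hTdef]; exact le_mul_of_one_le_right hq0.le (one_le_pow₀ hℓ1)
    have hT3 : 3 ≤ T := hq3.trans hqT
    have hT2 : 2 ≤ T := by linarith
    have hT6 : 6 ≤ T := by
      rw [hTdef]
      have : (6 : ℝ) ≤ 1 * 18 ^ 3 := by norm_num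
      exact this.trans (mul_le_mul hq1 (pow_le_pow_left₀ (by norm_num) hℓ18 3) (by positivity) hq0.le)
    -- the explicit formula, truncated at `T`
    have hEF := hK₁ q hq1n χ hprim x hx2 T hT2
    rw [sub_sub (-charZeroSumTrunc χ x T), ← hA, ← hψ0, ← hCχ] at hEF
    have hR : ‖ψ0 - (-charZeroSumTrunc χ x T - A + Cχ)‖ ≤ K₁' * ℓ + 9 * K₁' * X + K₁' * P := by
      have htr := truncation_term_le hxℓ hq1 hlogq9 hℓ1 hI3 hTdef
      rw [← hXdef] at htr
      have h2 : Real.log x * min 1 (x / (T * primePowDist x)) + x / T * Real.log (q * x * T) ^ 2 ≤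
          ℓ + 9 * X := add_le_add (hmin T) htr
      calc ‖ψ0 - (-charZeroSumTrunc χ x T - A + Cχ)‖ ≤ K₁ * _ := hEF
        _ ≤ K₁' * (Real.log x * min 1 (x / (T * primePowDist x)) + x / T * Real.log (q * x * T) ^ 2) :=
            mul_le_mul_of_nonneg_right hK₁le (hF1nn T hT0)
        _ ≤ K₁' * (ℓ + 9 * X) := mul_le_mul_of_nonneg_left h2 hK₁'0
        _ = K₁' * ℓ + 9 * K₁' * X := by ring
        _ ≤ K₁' * ℓ + 9 * K₁' * X + K₁' * P := by
            have : 0 ≤ K₁' * P := mul_nonneg hK₁'0 hP0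
            linarith
    -- the zeros: zero-free region and trivial counts only
    have hcount : ∀ P : Finset ℂ, (∀ ρ ∈ P, ρ ∈ lfunctionZeroBox χ T) →
        ∑ ρ ∈ P, (DirichletDisc.zeroOrder χ ρ : ℝ) ≤ Cb * T * Real.log T :=
      fun P hP => hbox q χ hprim hq1n T hT6 hqT P hP
    have ht1 : 4 * Cb * ℓ ^ 5 ≤ Real.exp (5 / 18 * ℓ) := ht₃ ℓ (ht₃Lq.trans hLqℓ)
    have ht2a : 16 * Real.exp 1 * Cb * Lq ≤ q := by
      have h := ht₄ Lq ht₄Lq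
      rw [pow_one, one_mul] at h
      rwa [hqexp]
    have ht2b : (q : ℝ) < ℓ →
        16 * Real.exp 1 * Cb * ℓ ^ 7 * Real.exp (-(c' / 12 * ℓ / Real.log ℓ)) ≤ 1 :=
      fun hqℓ' => hℓ₁ ℓ (hqℓ₁.trans hqℓ'.le)
    have h4PS := zeroSum_le_regimeZ hχ1 (β := β) hxℓ hLqdef hq3 hTdef hℓ18 hqℓ hI3 hZreg.le hκ84
      hc' hc'1 hCb.le (hZFR T hT3) hcount ht1 ht2a ht2b
    rw [← hXdef] at h4PS
    have h8 : 0 ≤ 8 * K₂ * P := by positivity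
    exact key T hT0.le hR (by linarith)

end SiegelZero

end Literature.NumberTheory.LFunctions
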